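import Mathlib

/-!
# Self-converse lift of a gadget of direct pairs (support file, siege attempt k8)

Item `stmt-MatrixMultiplication-14308` (`FourierTwoFamiliesModP.PrimeTwoFamilies`, CKSU 2005 Conj. 4.7 with
prime cyclic hosts), line `Sketch`, registered stub `selfConverseLift`.

Setting.  `P Q : Fin r → Finset K` is a GADGET in an abelian group `K`: every letter `(P c, Q c)` is a
DIRECT pair (`hD`: `(x - x') + (y - y') = 0 → x = x' ∧ y = y'` inside one letter).  Letter `σ` is
STRONGLY SEPARATED towards `τ` when every cross difference `q - p` (`p ∈ P σ`, `q ∈ Q τ`) avoids every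
diagonal difference `q' - p'` (`p' ∈ P c`, `q' ∈ Q c`, any letter `c`).  A map `π` on letters is a
SEPARATION CERTIFICATE (`hπ`) if for every ordered pair `σ ≠ τ` it names a coordinate — the letters
themselves, or their `π`-images — in which `σ` is strongly separated towards `τ`.

Claim (`selfConverseLift`).  The `r` product blocks `(P σ ×ˢ P (π σ), Q σ ×ˢ Q (π σ))` of `K × K`
satisfy the two clauses of the simultaneous double product property verbatim: (W) each block is direct,
(X) a relation `(a - a') + (b - b') = 0` with `a` from block `i`, `a', b` from block `j`, `b'` from
block `k` forces `i = k`.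

Proof organisation ("certificate check").  The argument has a finite core that is independent of `K`:
* `direct_prod` — a product of two direct pairs is direct (clause (W), coordinatewise);
* `sepTest_false` — ONE COORDINATE TEST: a strong separation of `σ` towards `τ` is refuted by any
  single-coordinate relation `(p - p') + (q' - q) = 0` with outer letters `p ∈ P σ`, `q ∈ Q τ` and inner
  letters `p' ∈ P c`, `q' ∈ Q c`;
* clause (X): a relation between blocks `i, j, k` projects to such a single-coordinate relation in BOTH
  coordinates (outer letters `i, k`, resp. `π i, π k`), so whichever coordinate the certificate `hπ i k`
  names is refuted — hence `i = k`.

Mathlib only; no computation.  (The same statement was landed by the line's lead as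
`…Theorems.PrimeTwoFamilies.CapacityLift.selfConverseLift`; this file is an independent proof in its own
namespace, as required by the siege protocol.)
-/

-- single-conjunct summit: the mandated namespace repeats `MatrixMultiplication` (summit = sub-problem).
set_option linter.dupNamespace false

namespace Summit.MatrixMultiplication.MatrixMultiplication.Theorems.PrimeTwoFamilies.SelfConverseLiftK8

open Finset

/-- **Product of direct pairs is direct.**  If `(X₁, Y₁)` and `(X₂, Y₂)` are direct pairs of finite sets in
abelian groups `K₁`, `K₂` (a relation `(x - x') + (y - y') = 0` inside the pair forces `x = x'` and
`y = y'`), then `(X₁ ×ˢ X₂, Y₁ ×ˢ Y₂)` is a direct pair in `K₁ × K₂`. -/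
theorem direct_prod {K₁ K₂ : Type*} [AddCommGroup K₁] [AddCommGroup K₂]
    {X₁ Y₁ : Finset K₁} {X₂ Y₂ : Finset K₂}
    (h₁ : ∀ x ∈ X₁, ∀ x' ∈ X₁, ∀ y ∈ Y₁, ∀ y' ∈ Y₁, (x - x') + (y - y') = 0 → x = x' ∧ y = y')
    (h₂ : ∀ x ∈ X₂, ∀ x' ∈ X₂, ∀ y ∈ Y₂, ∀ y' ∈ Y₂, (x - x') + (y - y') = 0 → x = x' ∧ y = y') :
    ∀ a ∈ X₁ ×ˢ X₂, ∀ a' ∈ X₁ ×ˢ X₂, ∀ b ∈ Y₁ ×ˢ Y₂, ∀ b' ∈ Y₁ ×ˢ Y₂,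
      (a - a') + (b - b') = 0 → a = a' ∧ b = b' := by
  intro a ha a' ha' b hb b' hb' h
  rw [Finset.mem_product] at ha ha' hb hb'
  obtain ⟨e₁, e₂⟩ := Prod.ext_iff.1 h
  simp only [Prod.fst_add, Prod.fst_sub, Prod.fst_zero, Prod.snd_add, Prod.snd_sub, Prod.snd_zero]
    at e₁ e₂
  obtain ⟨hx₁, hy₁⟩ := h₁ a.1 ha.1 a'.1 ha'.1 b.1 hb.1 b'.1 hb'.1 e₁
  obtain ⟨hx₂, hy₂⟩ := h₂ a.2 ha.2 a'.2 ha'.2 b.2 hb.2 b'.2 hb'.2 e₂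
  exact ⟨Prod.ext hx₁ hx₂, Prod.ext hy₁ hy₂⟩

/-- **One coordinate test.**  If letter `σ` is strongly separated towards letter `τ` (`hs`: every cross
difference `q - p`, `p ∈ P σ`, `q ∈ Q τ`, differs from every diagonal difference `q' - p'`, `p' ∈ P c`,
`q' ∈ Q c`), then there is no relation `(p - p') + (q' - q) = 0` with `p ∈ P σ`, `p' ∈ P c`, `q' ∈ Q c`,
`q ∈ Q τ`: such a relation says precisely `q - p = q' - p'`. -/
theorem sepTest_false {K : Type*} [AddCommGroup K] {r : ℕ} {P Q : Fin r → Finset K} {σ τ : Fin r}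
    (hs : ∀ p ∈ P σ, ∀ q ∈ Q τ, ∀ c : Fin r, ∀ p' ∈ P c, ∀ q' ∈ Q c, q - p ≠ q' - p')
    (c : Fin r) {p p' q' q : K} (hp : p ∈ P σ) (hp' : p' ∈ P c) (hq' : q' ∈ Q c) (hq : q ∈ Q τ)
    (h : (p - p') + (q' - q) = 0) : False := by
  refine hs p hp q hq c p' hp' q' hq' ?_
  have e : (p - p') + (q' - q) = (q' - p') - (q - p) := by abel
  rw [e, sub_eq_zero] at h
  exact h.symm

/-- **SELF-CONVERSE LIFT** (registered stub `selfConverseLift` of crux `stmt-MatrixMultiplication-14308`,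
verbatim signature).  If every letter `(P c, Q c)` of a gadget in an abelian group `K` is direct (`hD`) and
a map `π` on the letters certifies, for every ordered pair of distinct letters `σ ≠ τ`, a strong separation
of `σ` towards `τ` either directly or after `π` (`hπ`), then the `r` blocks
`(P σ ×ˢ P (π σ), Q σ ×ˢ Q (π σ))` of `K × K` satisfy clause (W) (first conjunct: each block is direct)
and clause (X) (second conjunct: a relation across blocks `i, j, j, k` forces `i = k`) of the simultaneous
double product property.  Proof: (W) is `direct_prod`; for (X) the relation projects to a one-coordinate
relation with outer letters `i, k` (first coordinate) and `π i, π k` (second), and `sepTest_false` refutes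
whichever coordinate the certificate `hπ i k` names. -/
theorem selfConverseLift {K : Type*} [AddCommGroup K] [DecidableEq K] {r : ℕ} (P Q : Fin r → Finset K)
    (hD : ∀ c : Fin r, ∀ x ∈ P c, ∀ x' ∈ P c, ∀ y ∈ Q c, ∀ y' ∈ Q c,
      (x - x') + (y - y') = 0 → x = x' ∧ y = y')
    (π : Fin r → Fin r)
    (hπ : ∀ σ τ : Fin r, σ ≠ τ →
      (∀ p ∈ P σ, ∀ q ∈ Q τ, ∀ c : Fin r, ∀ p' ∈ P c, ∀ q' ∈ Q c, q - p ≠ q' - p') ∨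
      (∀ p ∈ P (π σ), ∀ q ∈ Q (π τ), ∀ c : Fin r, ∀ p' ∈ P c, ∀ q' ∈ Q c, q - p ≠ q' - p')) :
    (∀ σ : Fin r, ∀ a ∈ P σ ×ˢ P (π σ), ∀ a' ∈ P σ ×ˢ P (π σ), ∀ b ∈ Q σ ×ˢ Q (π σ),
      ∀ b' ∈ Q σ ×ˢ Q (π σ), (a - a') + (b - b') = 0 → a = a' ∧ b = b') ∧
    (∀ i j k : Fin r, ∀ a ∈ P i ×ˢ P (π i), ∀ a' ∈ P j ×ˢ P (π j), ∀ b ∈ Q j ×ˢ Q (π j),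
      ∀ b' ∈ Q k ×ˢ Q (π k), (a - a') + (b - b') = 0 → i = k) := by
  refine ⟨fun σ => direct_prod (h₁ := hD σ) (h₂ := hD (π σ)), ?_⟩
  intro i j k a ha a' ha' b hb b' hb' h
  rw [Finset.mem_product] at ha ha' hb hb'
  -- the relation, read in each coordinate
  obtain ⟨e₁, e₂⟩ := Prod.ext_iff.1 h
  simp only [Prod.fst_add, Prod.fst_sub, Prod.fst_zero, Prod.snd_add, Prod.snd_sub, Prod.snd_zero]
    at e₁ e₂
  -- check the certificate for the ordered pair (i, k)
  by_contra hik
  rcases hπ i k hik with hs | hs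
  · exact sepTest_false hs j ha.1 ha'.1 hb.1 hb'.1 e₁
  · exact sepTest_false hs (π j) ha.2 ha'.2 hb.2 hb'.2 e₂

end Summit.MatrixMultiplication.MatrixMultiplication.Theorems.PrimeTwoFamilies.SelfConverseLiftK8
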